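import Literature.Analysis.FluidPDE.TypeIAncientMildClassical
import Literature.Analysis.FluidPDE.KNSSSmoothingHolds
import Literature.Analysis.FluidPDE.NSBoundedMildOseenClassical
import Literature.Analysis.FluidPDE.PressureReconstruction
import Literature.Analysis.FluidPDE.OseenHeatDuality
import HarnessLib

/-! # Oseen-mild Type-I fields on the past are classical — crux stmt-NavierStokesRegularity-1404 (`QuantisedSymmetry.PolyhedralDssProfileExists`), line polyhedral_cell, stub stub_classicalOfOseenMildPast

Registered stub `stub_classicalOfOseenMildPast` (`--supports stmt-NavierStokesRegularity-1404`):
a field `u` on the past `(−∞, 0) × ℝ³` which is jointly continuous on the open past, weakly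
divergence free slice by slice, Oseen-mild between all pairs of times `s < t < 0`
(`u(t) = e^{(t−s)Δ}u(s) − B¹ₛ(u,u)(t)`, the Koch–Nadirashvili–Seregin–Šverák gauge, tree objects
`heatFlow`, `oseenDuhamel`) and obeys the Type-I time rate `‖u(t, x)‖ ≤ C/√(−t)`
(`HasTypeITimeDecay C u`) is a CLASSICAL Navier–Stokes solution on `(−∞, 0)` (`ν = 1`, zero
force) for some jointly smooth pressure (`IsClassicalNSSolutionOn (Iio 0) 1 0 u p`).

Proof (assembly of proved tree facts).
1. *Smoothness on windows.* On every window `(s, T₁)`, `s < T₁ < 0`, the field is bounded by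
   `C/√(−T₁)` together with its datum `u(s)`, jointly measurable (continuity), and satisfies the
   Oseen integral equation from the bounded datum `u(s)`; KNSS 2009, Prop. 4.1, in the tree's
   discharged form `knss2009_smoothing_holds`, makes the right-hand side
   `e^{(t−s)Δ}u(s) − B¹ₛ(u,u)(t)` jointly `C^∞` on `(s, T₁) × ℝ³`, and it coincides with `u`
   there pointwise. Smoothness being local, `u` is jointly smooth on `(−∞, 0) × ℝ³`.
2. *Divergence free.* Smooth weakly divergence-free slices are divergence free
   (`IsWeaklyDivFree.isDivFree_of_contDiff`).
3. Hence `u` is in the KNSS class `IsTypeIAncientMild C u`, so it is classical on every window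
   `(t₀, 0)` (`IsTypeIAncientMild.exists_isClassicalNSSolutionOn_Ioo`, Fabes–Jones–Rivière).
4. *One pressure on `(−∞, 0)`.* At each `t < 0` the window momentum equation, tested against a
   smooth compactly supported divergence-free `φ`, gives `∫ ⟪∂ₜu + (u·∇)u − Δu, φ⟫ = 0` (the
   pressure gradient pairs to zero, `integral_fderiv_apply_eq_zero_of_isDivFree_test`; time
   derivatives within open time sets are two-sided); the global pressure is then reconstructed by
   `exists_isClassicalNSSolutionOn_of_forall_integral_inner_eq_zero` (de Rham–Poincaré), exactly
   as in the tree's `classical_of_bounded_mild_L3_of_knss2009_smoothing`.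
-/

noncomputable section

-- the summit namespace `…NavierStokesRegularity.NavierStokesRegularity…` is the tree convention (D-0017)
set_option linter.dupNamespace false

namespace Summit.NavierStokesRegularity.NavierStokesRegularity.Theorems.PolyhedralDssProfileExists.PolyhedralCell

open MeasureTheory Set Function Filter Topology
open scoped RealInnerProductSpace Laplacian
open Literature.Analysis Literature.Analysis.FluidPDE

/-! ### Elementary consequences of the Type-I time rate and of continuity on the open past -/

/-- The Type-I constant of a field with `‖u(t, x)‖ ≤ C/√(−t)` is nonnegative:
`0 ≤ ‖u(−1, 0)‖ ≤ C/√1 = C`. -/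
theorem hasTypeITimeDecay_const_nonneg
    {u : ℝ → EuclideanSpace ℝ (Fin 3) → EuclideanSpace ℝ (Fin 3)} {C : ℝ}
    (hI : HasTypeITimeDecay C u) : 0 ≤ C := by
  have h1 := hI (-1) (by norm_num) 0
  rw [neg_neg, Real.sqrt_one, div_one] at h1
  exact (norm_nonneg _).trans h1

/-- Uniform bound below a negative time: for `t ≤ T₁ < 0`, `‖u(t, x)‖ ≤ C/√(−T₁)` (monotonicity
of `C/√(−t)`, `0 ≤ C`). -/
theorem norm_le_of_hasTypeITimeDecay_of_le
    {u : ℝ → EuclideanSpace ℝ (Fin 3) → EuclideanSpace ℝ (Fin 3)} {C : ℝ}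
    (hI : HasTypeITimeDecay C u) {t T₁ : ℝ} (htT : t ≤ T₁) (hT : T₁ < 0)
    (x : EuclideanSpace ℝ (Fin 3)) : ‖u t x‖ ≤ C / Real.sqrt (-T₁) := by
  refine (hI t (lt_of_le_of_lt htT hT) x).trans ?_
  exact div_le_div_of_nonneg_left (hasTypeITimeDecay_const_nonneg hI)
    (Real.sqrt_pos.2 (neg_pos.2 hT)) (Real.sqrt_le_sqrt (by linarith))

/-- The slices below a negative time `T₁` are essentially bounded by `C/√(−T₁)`. -/
theorem eLpNorm_top_le_of_hasTypeITimeDecay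
    {u : ℝ → EuclideanSpace ℝ (Fin 3) → EuclideanSpace ℝ (Fin 3)} {C : ℝ}
    (hI : HasTypeITimeDecay C u) {t T₁ : ℝ} (htT : t ≤ T₁) (hT : T₁ < 0) :
    eLpNorm (u t) ⊤ volume ≤ ENNReal.ofReal (C / Real.sqrt (-T₁)) := by
  rw [eLpNorm_exponent_top]
  exact eLpNormEssSup_le_of_ae_bound
    (Eventually.of_forall fun x => norm_le_of_hasTypeITimeDecay_of_le hI htT hT x)

/-- A field jointly continuous on the open past is jointly a.e. strongly measurable on every
window `(s, T₁) × ℝ³`, `T₁ ≤ 0`. -/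
theorem aestronglyMeasurable_window_of_continuousOn_past
    {u : ℝ → EuclideanSpace ℝ (Fin 3) → EuclideanSpace ℝ (Fin 3)}
    (hcont : ContinuousOn (uncurry u) (Iio 0 ×ˢ univ)) {s T₁ : ℝ} (hT : T₁ ≤ 0) :
    AEStronglyMeasurable (uncurry u)
      ((volume : Measure (ℝ × EuclideanSpace ℝ (Fin 3))).restrict (Ioo s T₁ ×ˢ univ)) :=
  (hcont.mono (prod_mono (fun _ hτ => lt_of_lt_of_le hτ.2 hT) subset_rfl)).aestronglyMeasurable
    (measurableSet_Ioo.prod MeasurableSet.univ)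

/-! ### KNSS 2009, Prop. 4.1: joint smoothness on the open past -/

/-- **Joint smoothness on windows** (KNSS 2009, Prop. 4.1, via the discharged tree fact
`knss2009_smoothing_holds`). A field which is jointly continuous on the open past, Oseen-mild
between all pairs of negative times and Type-I bounded in time is jointly `C^∞` on every window
`(s, T₁) × ℝ³`, `s < T₁ < 0`: on the window it is a bounded (by `C/√(−T₁)`) solution of the Oseen
integral equation from the bounded datum `u(s)`, so the smooth representative
`e^{(t−s)Δ}u(s) − B¹ₛ(u,u)(t)` of Prop. 4.1 coincides with it pointwise. -/
theorem isSmoothSpaceTimeOn_window_of_oseenMild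
    {u : ℝ → EuclideanSpace ℝ (Fin 3) → EuclideanSpace ℝ (Fin 3)} {C : ℝ}
    (hcont : ContinuousOn (uncurry u) (Iio 0 ×ˢ univ))
    (hmild : ∀ s t : ℝ, s < t → t < 0 → ∀ x,
      u t x = heatFlow (u s) (t - s) x - oseenDuhamel 1 s u u t x)
    (hI : HasTypeITimeDecay C u) {s T₁ : ℝ} (hsT : s < T₁) (hT : T₁ < 0) :
    IsSmoothSpaceTimeOn (Ioo s T₁) u := by
  have hs : s < 0 := hsT.trans hT
  -- the datum `u s` is a continuous slice (compose with `x ↦ (s, x)`; the tree's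
  -- `KnownCases.continuous_slice` of the Galdi–Liouville gate, not imported here)
  have hsl : Continuous (u s) :=
    hcont.comp_continuous (continuous_const.prodMk continuous_id)
      fun x => mk_mem_prod (mem_Iio.2 hs) (mem_univ x)
  have hM : 0 ≤ C / Real.sqrt (-T₁) :=
    div_nonneg (hasTypeITimeDecay_const_nonneg hI) (Real.sqrt_nonneg _)
  -- the Oseen identity on the window, the heat flow realised as the caloric extension
  have hid : ∀ t ∈ Ioo s T₁, ∀ x, u t x =
      UnboundedOperators.heatExtension (u s) (1 * (t - s)) x - oseenDuhamel 1 s u u t x := by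
    intro t ht x
    rw [one_mul, hmild s t ht.1 (ht.2.trans hT) x, heatFlow_of_pos _ (sub_pos.2 ht.1)]
  have hP := knss2009_smoothing_holds (EuclideanSpace ℝ (Fin 3)) one_pos hsT hM
    hsl.aestronglyMeasurable
    (eLpNorm_top_le_of_hasTypeITimeDecay hI hsT.le hT)
    (aestronglyMeasurable_window_of_continuousOn_past hcont hT.le)
    (fun t ht => eLpNorm_top_le_of_hasTypeITimeDecay hI ht.2.le hT)
    (fun t ht => Eventually.of_forall (hid t ht))
  refine hP.1.congr ?_
  rintro ⟨t, x⟩ hz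
  obtain ⟨ht, -⟩ := mem_prod.1 hz
  exact hid t ht x

/-- **Joint smoothness on the open past** (KNSS 2009, Prop. 4.1): smoothness is local
(`contDiffOn_of_locally_contDiffOn`), and every `(t, x)` with `t < 0` lies in the open window
`(t − 1, t/2) × ℝ³` on which `isSmoothSpaceTimeOn_window_of_oseenMild` applies. -/
theorem isSmoothSpaceTimeOn_past_of_oseenMild
    {u : ℝ → EuclideanSpace ℝ (Fin 3) → EuclideanSpace ℝ (Fin 3)} {C : ℝ}
    (hcont : ContinuousOn (uncurry u) (Iio 0 ×ˢ univ))
    (hmild : ∀ s t : ℝ, s < t → t < 0 → ∀ x,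
      u t x = heatFlow (u s) (t - s) x - oseenDuhamel 1 s u u t x)
    (hI : HasTypeITimeDecay C u) : IsSmoothSpaceTimeOn (Iio 0) u := by
  refine contDiffOn_of_locally_contDiffOn ?_
  rintro ⟨t, x⟩ hz
  obtain ⟨ht, -⟩ := mem_prod.1 hz
  have ht0 : t < 0 := ht
  refine ⟨Ioo (t - 1) (t / 2) ×ˢ univ, isOpen_Ioo.prod isOpen_univ,
    mk_mem_prod ⟨by linarith, by linarith⟩ (mem_univ _), ?_⟩
  have hsub : (Iio (0 : ℝ) ×ˢ (univ : Set (EuclideanSpace ℝ (Fin 3)))) ∩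
      Ioo (t - 1) (t / 2) ×ˢ univ = Ioo (t - 1) (t / 2) ×ˢ univ := by
    rw [inter_eq_right]
    exact prod_mono (fun τ hτ => mem_Iio.2 (hτ.2.trans (by linarith))) subset_rfl
  rw [hsub]
  exact isSmoothSpaceTimeOn_window_of_oseenMild hcont hmild hI (by linarith) (by linarith)

/-! ### The KNSS class and the classical equations on the past -/

/-- **The field is a Type-I ancient mild field in the KNSS gauge** (`IsTypeIAncientMild C u`):
joint smoothness on the open past (`isSmoothSpaceTimeOn_past_of_oseenMild`), pointwise
`div u(t) = 0` from the weak condition for the smooth slices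
(`IsWeaklyDivFree.isDivFree_of_contDiff`), the Oseen equation and the Type-I rate as given. -/
theorem isTypeIAncientMild_of_oseenMild_past
    {u : ℝ → EuclideanSpace ℝ (Fin 3) → EuclideanSpace ℝ (Fin 3)} {C : ℝ}
    (hcont : ContinuousOn (uncurry u) (Iio 0 ×ˢ univ))
    (hwdiv : ∀ t < 0, IsWeaklyDivFree (u t))
    (hmild : ∀ s t : ℝ, s < t → t < 0 → ∀ x,
      u t x = heatFlow (u s) (t - s) x - oseenDuhamel 1 s u u t x)
    (hI : HasTypeITimeDecay C u) : IsTypeIAncientMild C u := by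
  have hsm : IsSmoothSpaceTimeOn (Iio 0) u := isSmoothSpaceTimeOn_past_of_oseenMild hcont hmild hI
  refine ⟨hsm, fun t ht => ?_, hmild, hI⟩
  exact (hwdiv t ht).isDivFree_of_contDiff
    ((hsm.contDiff_slice (mem_Iio.2 ht)).of_le (by exact_mod_cast le_top))

/-- **One pressure on the whole past.** A Type-I ancient mild field in the KNSS gauge is a
classical Navier–Stokes solution on `(−∞, 0)` (`ν = 1`, zero force) for some jointly smooth
pressure: it is classical on every window `(t₀, 0)`
(`IsTypeIAncientMild.exists_isClassicalNSSolutionOn_Ioo`, Fabes–Jones–Rivière 1972), so at each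
`t < 0` the momentum equation tested against smooth compactly supported divergence-free fields
holds in the pressure-free form (the pressure gradient pairs to zero,
`integral_fderiv_apply_eq_zero_of_isDivFree_test`; the time derivatives within the open sets
`(t − 1, 0)` and `(−∞, 0)` are both the two-sided derivative), and the global pressure is
reconstructed by `exists_isClassicalNSSolutionOn_of_forall_integral_inner_eq_zero`. -/
theorem exists_isClassicalNSSolutionOn_Iio_of_isTypeIAncientMild
    {u : ℝ → EuclideanSpace ℝ (Fin 3) → EuclideanSpace ℝ (Fin 3)} {C : ℝ}
    (hK : IsTypeIAncientMild C u) :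
    ∃ p : ℝ → EuclideanSpace ℝ (Fin 3) → ℝ, IsClassicalNSSolutionOn (Iio 0) 1 0 u p := by
  have hsm : IsSmoothSpaceTimeOn (Iio 0) u := hK.contDiffOn
  have hf : IsSmoothSpaceTimeOn (Iio 0)
      (0 : ℝ → EuclideanSpace ℝ (Fin 3) → EuclideanSpace ℝ (Fin 3)) := contDiffOn_const
  refine exists_isClassicalNSSolutionOn_of_forall_integral_inner_eq_zero isOpen_Iio hsm hf
    (fun t ht => hK.isDivFree ht) ?_
  intro t ht φ hφ hφdiv
  have ht0 : t < 0 := ht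
  obtain ⟨p, hcl⟩ := hK.exists_isClassicalNSSolutionOn_Ioo (t₀ := t - 1) (by linarith)
  have ht' : t ∈ Ioo (t - 1) 0 := ⟨by linarith, ht0⟩
  -- the time derivatives within the two open time sets are the two-sided derivative
  have hder : ∀ x, timeDerivWithin (Ioo (t - 1) 0) u t x = timeDerivWithin (Iio 0) u t x := by
    intro x
    simp only [timeDerivWithin_apply]
    rw [derivWithin_of_isOpen isOpen_Ioo ht', derivWithin_of_isOpen isOpen_Iio ht]
  -- the tested integrand is `-∇p(t)`
  have hG : ∀ x, timeDerivWithin (Iio 0) u t x + convect (u t) (u t) x - (1 : ℝ) • (Δ (u t)) x -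
      (0 : ℝ → EuclideanSpace ℝ (Fin 3) → EuclideanSpace ℝ (Fin 3)) t x = -gradient (p t) x := by
    intro x
    have hm := hcl.momentum t ht' x
    rw [hder x] at hm
    rw [hm]
    simp only [Pi.zero_apply, add_zero, sub_zero]
    abel
  simp_rw [hG, inner_neg_left, MeasureTheory.integral_neg, neg_eq_zero]
  have hpc : ContDiff ℝ (⊤ : ℕ∞) (p t) := hcl.contDiff_pressure ht'
  simp_rw [real_inner_comm (φ _), inner_gradient_eq_fderiv_apply]
  exact integral_fderiv_apply_eq_zero_of_isDivFree_test hφ hφdiv hpc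

/-! ### The registered stub -/

/-- **Stub `stub_classicalOfOseenMildPast` (Oseen-mild on the past ⇒ classical).** A field on
`(−∞, 0) × ℝ³` which is jointly continuous on the open past, weakly divergence free slice by
slice, Oseen-mild between all pairs `s < t < 0` (`u(t) = e^{(t−s)Δ}u(s) − B¹ₛ(u,u)(t)`) and Type-I
bounded in time (`‖u(t, x)‖ ≤ C/√(−t)`) is a classical solution of Navier–Stokes (`ν = 1`, zero
force) on `(−∞, 0)` for some jointly smooth pressure (KNSS 2009, Prop. 4.1 + Fabes–Jones–Rivière
1972, Thm. 2.1, with the de Rham–Poincaré pressure), via `isTypeIAncientMild_of_oseenMild_past`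
and `exists_isClassicalNSSolutionOn_Iio_of_isTypeIAncientMild`. -/
theorem stub_classicalOfOseenMildPast :
    ∀ (u : ℝ → EuclideanSpace ℝ (Fin 3) → EuclideanSpace ℝ (Fin 3)) (C : ℝ),
      ContinuousOn (Function.uncurry u) (Set.Iio 0 ×ˢ Set.univ) →
      (∀ t < 0, IsWeaklyDivFree (u t)) →
      (∀ s t : ℝ, s < t → t < 0 → ∀ x,
        u t x = heatFlow (u s) (t - s) x - oseenDuhamel 1 s u u t x) →
      HasTypeITimeDecay C u →
      ∃ p : ℝ → EuclideanSpace ℝ (Fin 3) → ℝ, IsClassicalNSSolutionOn (Set.Iio 0) 1 0 u p := by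
  intro u C hcont hwdiv hmild hI
  exact exists_isClassicalNSSolutionOn_Iio_of_isTypeIAncientMild
    (isTypeIAncientMild_of_oseenMild_past hcont hwdiv hmild hI)

end Summit.NavierStokesRegularity.NavierStokesRegularity.Theorems.PolyhedralDssProfileExists.PolyhedralCell
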